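/-
Copyright (c) 2026 the pub-hodgecm-mathlib formalisation cell (harness21).  Prover seat hodgecm-mathlib-K2E3-p21 (g2), HCML Track B «K2-LIT» (build stream 29),
h413 = `stmt-HodgeConjecture-24833`, line `K2_E3_EllipticInputs`, unit U3: THE TIER-0 STUB 3 `stub_cubicGermResidue` BY NAME (dealer K2E3-plan (g2) DEAL
`K2/STATUS.md` 2026-09-04T00:23:22Z).  2026-09-04.
-/
import Summits.HodgeConjecture.HodgeConjecture.Theorems.K2E3CubicTorusTypeThreeExists          -- ★ p854975 (K2E3-p01, U3-a): `CubicTorusTypeThreeExists` (socket #1 `sig_K2E3CubicTorusTypeThreeExists`)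
import Summits.HodgeConjecture.HodgeConjecture.Theorems.K2E3ShalikaGermExpansionDyadic        -- ★ p855098 (K2E3-p01, U3-b): `shalikaGermExpansionNonsplit_of_nonsplit` (socket #2 at every non-split place)
import Summits.HodgeConjecture.HodgeConjecture.Theorems.K2E3GermResidueAtCubicTorusOfRay        -- ★ p855129 (K2E3-p03, U3-c ⟸ #3H): `germResidueAtCubicTorus_of_ray`
import Summits.HodgeConjecture.HodgeConjecture.Theorems.K2E3ShalikaGermHomogeneityRay          -- ★ p856179 (K2E3-p03, #3H ED. 3): `shalikaGermHomogeneityRay` (unconditional over FILE C ★)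
import HarnessLib

/-!
# h413 ∕ Track B «K2-LIT», line `K2_E3_EllipticInputs`, unit U3: TIER-0 STUB 3 `stub_cubicGermResidue` — A CARTAN SUBGROUP OF TYPE (3) AND THE CONSTANT
# TERM OF THE SHALIKA GERM EXPANSION ON IT, AT EVERY NON-SPLIT FINITE PLACE OF `L⁺`

Cell `pub/hodgecm-mathlib`, crux H413 = `stmt-HodgeConjecture-24833`, route of record `HCCMUnconditional`; chair K2-lead (g0), dealer K2E3-plan (g2), line lead of U3-d
K2E3-p03 (g2).  THEOREMS ONLY (no `def`, no `instance`, no `notation`, no named-fact hypothesis, no `sorry`); imports = ★ Theorems + HarnessLib (never `Cruxes/…/Lines`);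
lane `--supports stmt-HodgeConjecture-24833 --as helper`.  The dealer ties the tier-0 `…Cruxes.H413.K2E3EllipticInputs.stub_cubicGermResidue` (bytes frozen,
`Lines/K2_E3_EllipticInputs.lean` :108–119) to THIS head by name in tier-0 ED. 3.

THE STATEMENT (`cubicGermResidue`, = the stub with the `Lines` abbreviation `Pl L` inlined as `HeightOneSpectrum (𝓞 L⁺)`): at a finite place `v` of `L⁺` non-split in `L`, for a
two-sided Haar measure `νQv` and a canonical orbital family `mQv` on `U(Φ₃)(L⁺_v)`, there is a subgroup `T` whose regular elements have characteristic polynomial without a root in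
`L ⊗ L⁺_v` (print's type (3)) and on which the Shalika germ expansion has the residue package ★ `ShalikaGermResidueAtTorus`.

THE PROOF is the socket module's sorry-free composition `U3CubicGerms.cubicGermResidue_of_sigs₂` (never imported) written over the ★ socket payers: U3-a ★ p854975
`CubicTorusTypeThreeExists` gives `T` (compact, the centraliser of a regular `γ₀`, type (3), with a regular sequence `→ 1`); U3-c ★ p855129 `germResidueAtCubicTorus_of_ray`
— fed with #3H ★ p856179 `shalikaGermHomogeneityRay` (the homogeneity ray, now unconditional over the FILE C scaling law ★ p856049 ∘ ★ p856078) and with the germ expansion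
U3-b ★ p855098 `shalikaGermExpansionNonsplit_of_nonsplit` — gives the residue package on `T`.

HONEST LABEL.  HC_CM is proved only modulo the 7 printed citations (2 remaining named inputs: hLiu418 = `stmt-HodgeConjecture-24832`, h413 =
`stmt-HodgeConjecture-24833`) until rung 0 closes; this file is count-neutral (helper lane) — the tier-0 stub moves only at the dealer's ED. 3 tie.

## References
* [Rogawski1990] J. D. Rogawski, *Automorphic Representations of Unitary Groups in Three Variables*, Ann. of Math. Stud. 123 (1990): §3.6 p. 31 (Cartan subgroups of type (3));
  §8.1 Prop. 8.1.1 p. 112, Prop. 8.1.2 (b) p. 114, (8.1.1)–(8.1.2) p. 116; §12.7 p. 194 (the constant term on a type-(3) torus).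
* [HarishChandra1999AdmissibleDistributions] Harish-Chandra, *Admissible Invariant Distributions on Reductive p-adic Groups*, ULS 16 (1999), Thm. 8.1 p. 48; §3.1 Lemma 3.2.
* [Kottwitz1988] R. Kottwitz, *Tamagawa numbers*, Ann. of Math. 127 (1988), §2 Theorem 2 (Euler–Poincaré functions).
-/

set_option autoImplicit false
set_option linter.dupNamespace false  -- the mandated namespace repeats the single-problem summit's segment (`HodgeConjecture.HodgeConjecture`)

noncomputable section

open NumberField IsDedekindDomain MeasureTheory Filter Topology
open scoped Matrix MatrixGroups
open Literature.NumberTheory.Rogawski1990 Literature.NumberTheory.Automorphic Literature.NumberTheory.Automorphic.UnitaryGroup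

namespace Summit.HodgeConjecture.HodgeConjecture.Cruxes.H413.K2E3CubicGermResidue

set_option maxHeartbeats 1600000 in  -- statement-level `whnf` on the CM carriers (the tier-0 module's own budget line)
set_option synthInstance.maxHeartbeats 400000 in  -- idem
open scoped Classical in
/-- **TIER-0 STUB 3 (`stub_cubicGermResidue`): A CARTAN SUBGROUP OF TYPE (3) AND THE CONSTANT TERM OF THE GERM EXPANSION ON IT.**  At a finite place `v` of `L⁺`
non-split in `L`, for a two-sided Haar measure `νQv` and a CANONICAL orbital family `mQv` on `U(Φ₃)(L⁺_v)`: there is a subgroup `T` whose regular elements have characteristic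
polynomial WITHOUT a root in `L ⊗ L⁺_v` (type (3)) and on which ★ `ShalikaGermResidueAtTorus L Φ₃ v mQv T` holds.  Statement = the tier-0 stub with `Pl L` inlined; proof =
U3-a ★ p854975 + U3-b ★ p855098 + U3-c ★ p855129 ∘ #3H ★ p856179 (the socket module's `cubicGermResidue_of_sigs₂`, written over Theorems).
[cite: Rogawski1990, §3.6 p. 31; §8.1 Prop. 8.1.1 p. 112; Prop. 8.1.2 (b) p. 114; §12.7 p. 194] [cite: HarishChandra1999AdmissibleDistributions, Thm. 8.1 p. 48]
[cite: Kottwitz1988, §2 Theorem 2] -/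
theorem cubicGermResidue :
  ∀ (L : Type) [Field L] [NumberField L] [IsCMField L] (v : HeightOneSpectrum (𝓞 ↥(maximalRealSubfield L))),
    (∀ w : PlacesOver L v, IsCMField.complexConj L • w.1 = w.1) →
    ∀ [MeasurableSpace (Gqs L v)] [BorelSpace (Gqs L v)] (νQv : Measure (Gqs L v)) [νQv.IsHaarMeasure] [νQv.IsMulRightInvariant],
    letI : ∀ γ : Gqs L v, MeasurableSpace (Gqs L v ⧸ Subgroup.centralizer ({γ} : Set (Gqs L v))) := fun _ => borel _
    haveI : ∀ γ : Gqs L v, BorelSpace (Gqs L v ⧸ Subgroup.centralizer ({γ} : Set (Gqs L v))) := fun _ => ⟨rfl⟩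
    ∀ (mQv : OrbitalMeasureFamily (Gqs L v)),
      mQv.IsCanonical (fun γ => IsRegularElt (γ.val : GL (Fin 3) (UnitaryGroup.LocalRing L v))) νQv →
      ∃ (T : Subgroup (Gqs L v)),
        (∀ γ ∈ T, IsRegularElt (γ.val : GL (Fin 3) (UnitaryGroup.LocalRing L v)) → ∀ c : UnitaryGroup.LocalRing L v, ¬ ((γ.val.val : Matrix (Fin 3) (Fin 3) (UnitaryGroup.LocalRing L v)).charpoly).IsRoot c) ∧
        ShalikaGermResidueAtTorus L (qsForm L) v mQv T := by
  intro L _ _ _ v hns _ _ νQv _ _ mQv hcan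
  obtain ⟨T, hcpt, hγ₀, hT3, -⟩ := K2E3CubicTorusTypeThreeExists.CubicTorusTypeThreeExists L v hns
  exact ⟨T, hT3,
    K2E3GermResidueAtCubicTorusOfRay.germResidueAtCubicTorus_of_ray K2E3ShalikaGermHomogeneityRay.shalikaGermHomogeneityRay L v hns
      (K2E3ShalikaGermExpansionDyadic.shalikaGermExpansionNonsplit_of_nonsplit L v hns) νQv mQv hcan T ⟨hcpt, hγ₀⟩ hT3⟩

end Summit.HodgeConjecture.HodgeConjecture.Cruxes.H413.K2E3CubicGermResidue

end
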